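import Summits.Ventures.PercRepro.MSTightLocalDichotomy

/-!
# The local dichotomy, repaired: the candidate Prop `LocalDichotomy α` is FALSE as stated, and
# the genuine form that the lane's census actually supports

Dossier proofs/MINE1-theoremS.md, Addendum 51. The candidate Prop `LocalDichotomy α`
(MSTightLocalDichotomy.lean, p502335) carries the side conditions `∅ ∉ P` and `univ ∉ P` — but
those are NOT the genuine-trace conditions under which the lane's census was taken (the
enumerator of Addendum 50 suppl. 3 always has no core element and no free element, i.e. `∩P ∉ P`
and `∪P ∉ P`), nor the ones the lane's singleton theorems (MSTightConjTSingleton, p449345) carry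
(`∅ ∉ P`, `univ.erase r ∉ P`, empty core, full support off `r`). With a CORE ELEMENT the Prop
fails: on `{a, b, c, d}` the cone `P = {d, ad, bd, cd, abd, acd, bcd}` is tight, twin-free, with
`∅, univ ∉ P`; `K = {ad, bd}` has `D(K) = {∅, a, b}` (excess one); `P₁ = {d, abd}`,
`P₀ = {cd, acd, bcd}` satisfy every hypothesis (`P₁ \\ K = {∅, a, b}`, `K \\ P₀ = {∅, a, b}`),
and `abd` lies below no member of `K` (`not_localDichotomy_fin4`; the same cone with
`N = α ∖ {d}` works on every `α` with at least four elements, and its complement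
`2^{abc} ∖ {∅}` with `d` free is the mirror witness). So the bridge
`diffsY_subset_diffsX_of_localDichotomy` is vacuous for `|α| ≥ 4`.
**Repair.** `LocalDichotomyGenuine α` replaces `∅ ∉ P`, `univ ∉ P` by «`P` has NO MINIMUM and
NO MAXIMUM member» (⟺ `∩P ∉ P ∧ ∪P ∉ P`, the genuine conditions in coordinate-free,
self-dual form; for a twin-free tight `P` they say exactly that after removing the at most one
core element and the at most one free element the product `L ⊕ U` has `∅ ∉ U`, `N ∉ L`) — the
statement the census of Addendum 50 suppl. 3 (1,080 / 1,080 colourings of every tight genuine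
twin-free trace on 5 elements, 96 hill-climbed ones on 6–7) actually tests. The repaired BRIDGE
`diffsY_subset_diffsX_of_localDichotomyGenuine` takes the lane's standard genuine-trace
hypotheses (`∅ ∉ P`, empty core, `univ.erase r ∉ P`, full support off `r` — the hypotheses of
p449345) and gives Conjecture (T) on the open shape in case (β) exactly as before. The original
candidate implies the repaired one (`localDichotomyGenuine_of_localDichotomy`), so nothing
proved from the repaired form is lost.
-/

namespace PercRepro.MSTight

open Finset
open scoped FinsetFamily

variable (α : Type*) [DecidableEq α] [Fintype α]

/-- **The local dichotomy, genuine form (candidate Prop, never asserted).** For a tight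
twin-free family `P` with no minimum and no maximum member, an excess-one subfamily `K ⊆ P`
and a partition `P ∖ K = P₀ ⊔ P₁` with `|P₀|, |P₁| ≥ 2`, `P₁ \\ K ⊆ K \\ K` and
`K \\ P₀ ⊆ K \\ K`: every member of `P₁` lies below a member of `K`. -/
def LocalDichotomyGenuine : Prop :=
  ∀ (P K P₀ P₁ : Finset (Finset α)), Tight P → (∀ a b, Twin P a b → a = b) →
    (∀ t ∈ P, ∃ p ∈ P, ¬ t ⊆ p) → (∀ t ∈ P, ∃ p ∈ P, ¬ p ⊆ t) →
    K ⊆ P → P₀ ∪ P₁ = P \ K → Disjoint P₀ P₁ →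
    (K \\ K).card = K.card + 1 → P₁ \\ K ⊆ K \\ K → K \\ P₀ ⊆ K \\ K →
    2 ≤ P₀.card → 2 ≤ P₁.card → ∀ t ∈ P₁, ∃ k ∈ K, t ⊆ k

variable {α}

/-- The original candidate implies the repaired one (a minimum would be `∅`, a maximum `univ`). -/
theorem localDichotomyGenuine_of_localDichotomy (h : LocalDichotomy α) :
    LocalDichotomyGenuine α := by
  intro P K P₀ P₁ hP htf hmin hmax hK hU hD hβ h1 h0 hc0 hc1
  refine h P K P₀ P₁ hP htf ?_ ?_ hK hU hD hβ h1 h0 hc0 hc1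
  · intro hE
    obtain ⟨p, -, hp⟩ := hmin ∅ hE
    exact hp (empty_subset p)
  · intro hU'
    obtain ⟨p, -, hp⟩ := hmax univ hU'
    exact hp (subset_univ p)

/-- **The original candidate is false on `Fin 4`**: the cone `P = {d, ad, bd, cd, abd, acd, bcd}`
(`a, b, c, d = 0, 1, 2, 3`) with `K = {ad, bd}`, `P₁ = {d, abd}`, `P₀ = {cd, acd, bcd}`. -/
theorem not_localDichotomy_fin4 : ¬ LocalDichotomy (Fin 4) := by
  intro h
  have := h {{3}, {0, 3}, {1, 3}, {2, 3}, {0, 1, 3}, {0, 2, 3}, {1, 2, 3}} {{0, 3}, {1, 3}}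
    {{2, 3}, {0, 2, 3}, {1, 2, 3}} {{3}, {0, 1, 3}}
    (by unfold Tight; decide) (by unfold Twin; decide) (by decide) (by decide) (by decide)
    (by decide) (by decide) (by decide) (by decide) (by decide) (by decide) (by decide)
    {0, 1, 3} (by decide)
  revert this
  decide

variable {r : α} {F : Finset (Finset α)}

omit [Fintype α] in
/-- A genuine trace has no minimum member: a member below every member is `∅`. -/
theorem exists_not_subset_of_mem_proj (hcore : ∀ a, ∃ p ∈ proj r F, a ∉ p)
    (hE : (∅ : Finset α) ∉ proj r F) {t : Finset α} (ht : t ∈ proj r F) :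
    ∃ p ∈ proj r F, ¬ t ⊆ p := by
  by_contra hcon
  push Not at hcon
  have : t = ∅ := by
    apply eq_empty_of_forall_notMem
    intro a ha
    obtain ⟨p, hp, hap⟩ := hcore a
    exact hap (hcon p hp ha)
  exact hE (this ▸ ht)

/-- A genuine trace has no maximum member: a member above every member is `univ.erase r`. -/
theorem exists_not_superset_of_mem_proj (hsupp : ∀ a, a ≠ r → ∃ p ∈ proj r F, a ∈ p)
    (hS : univ.erase r ∉ proj r F) {t : Finset α} (ht : t ∈ proj r F) :
    ∃ p ∈ proj r F, ¬ p ⊆ t := by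
  by_contra hcon
  push Not at hcon
  have : t = univ.erase r := by
    ext a
    simp only [mem_erase, mem_univ, and_true]
    constructor
    · intro hat har
      have hr : r ∉ t := by
        obtain ⟨B, -, rfl⟩ := mem_proj.1 ht
        exact notMem_erase r B
      exact hr (har ▸ hat)
    · intro har
      obtain ⟨p, hp, hap⟩ := hsupp a har
      exact hcon p hp hap
  exact hS (this ▸ ht)

/-- **The repaired bridge.** Under `LocalDichotomyGenuine α`, Conjecture (T) holds at every
genuine twin-free tightening direction of an excess-one family in case (β) with at least two
partnerless members on each side (the open shape) — genuine in the lane's standard sense: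
`∅ ∉ P`, empty core, `univ.erase r ∉ P`, full support off `r` (the hypotheses of p449345). -/
theorem diffsY_subset_diffsX_of_localDichotomyGenuine (hL : LocalDichotomyGenuine α)
    (hF : (F \\ F).card = F.card + 1) (hP : Tight (proj r F))
    (htf : ∀ a b, Twin (proj r F) a b → a = b)
    (hE : (∅ : Finset α) ∉ proj r F) (hcore : ∀ a, ∃ p ∈ proj r F, a ∉ p)
    (hS : univ.erase r ∉ proj r F) (hsupp : ∀ a, a ≠ r → ∃ p ∈ proj r F, a ∈ p)
    (hβ : (partner r F \\ partner r F).card = (partner r F).card + 1)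
    (h0 : 2 ≤ (part0 r F \ partr r F).card) (h1 : 2 ≤ (partr r F \ part0 r F).card) :
    diffsY r F ⊆ diffsX r F := by
  -- case (β) of the tightening split: the two local inclusions
  have hsplit := tightening_split hF hP
  have hK1 : partr r F \\ partner r F = partner r F \\ partner r F := by
    rcases hsplit with ⟨hT, -⟩ | ⟨-, -, h, -⟩
    · exfalso
      unfold Tight at hT
      omega
    · exact h
  have hK0 : partner r F \\ part0 r F = partner r F \\ partner r F := by
    rcases hsplit with ⟨hT, -⟩ | ⟨-, -, -, h⟩
    · exfalso
      unfold Tight at hT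
      omega
    · exact h
  have hP1 : (partr r F \ part0 r F) \\ partner r F ⊆ partner r F \\ partner r F := by
    rw [← hK1]
    exact diffs_subset sdiff_subset (subset_refl _)
  have hP0 : partner r F \\ (part0 r F \ partr r F) ⊆ partner r F \\ partner r F := by
    rw [← hK0]
    exact diffs_subset (subset_refl _) sdiff_subset
  have hdich := hL (proj r F) (partner r F) (part0 r F \ partr r F) (partr r F \ part0 r F)
    hP htf (fun t ht => exists_not_subset_of_mem_proj hcore hE ht)
    (fun t ht => exists_not_superset_of_mem_proj hsupp hS ht)
    partner_subset_proj' partnerless_union_eq partnerless_disjoint hβ hP1 hP0 h0 h1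
  apply diffsY_subset_diffsX_of_dichotomy hP htf
  left
  intro t ht ht0
  exact hdich t (mem_sdiff.2 ⟨ht, ht0⟩)

end PercRepro.MSTight
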